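/-
Copyright: the b2b-balaban cell (near-miss cell 7), T⁴-continuum fan-out; row NE7b CRUX team (2), seat
t4-ne7b-formalise-leaf-03 (gen 22) (row S12 «ASSEMBLY» custodian; the OWNER's INTERFACE REQUEST NE7b IR-42-2 under
ruling R-OWNER-42-2 «M5's cost side is stated in TOTAL (lifeCost) form»).  Released under the licence of the
surrounding project.
-/
import Summits.QuantumFields.BalabanUV.T4Continuum.Support.HistoryAssemblyMultProfile

/-!
# History assembly, multiplicity socket: the profile-level slack WITH THE COST READING IN TOTAL FORM (IR-42-2, T0)

Summits-side support leaf of the T⁴-continuum cell (rung (B)+1 on a FINITE torus only; NOT infinite volume, NOT the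
mass gap, NOT the Clay statement; NOT a proof of the spine estimate NE7b, which is the cell's OWN estimate, NOT PRINTED
and NOT PROVED).  Row NE7b, route «COUNT», re-open object (α): the OWNER's ruling R-OWNER-42-2 reads the END's
realised-cost binder `hκ` in TOTAL form — `lifeCost (padW (dictWT sh R C.n₁) D) κ G ≤ lifeCost (padW …) (costT sh C K R) G`
over the padded life — instead of the STEPWISE form `∀ n ∈ life (padW …) G, κ G n ≤ costT sh C K R G n`; the located
design observation O-M5-1 (merger cascades realise several unit boxes at a step where `costT` books one floor) is why.
On the Mult road (the headline path of the S12-W work list) the stepwise binder is consumed ONLY by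
`HistoryAssemblyMultProfile.pshapeTH_mul_exp_le_shapeTH_of_profile` ∕ `card_mul_pshapeTH_le_priceT_of_profile`, and there
solely through `lifeCostT_mono h = Finset.sum_le_sum h`; this file states the two lemmas with the binder in total form
(proofs otherwise verbatim) and records, as kernel-checked `example`s, that the landed stepwise lemmas are the total ones
composed with `lifeCostT_mono`.  [folklore] arithmetic over the lineage's OWN price letters
(`HistoryConstantsTH.pshapeTH`, `HistoryAssemblyTerms.priceT`, `HistoryConstants.shapeTH`); nothing quoted from print,
nothing printed asserted, no `[cite:]` tag, no definition, no `Prop` fact, zero `sorry`.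

WHAT.  `pshapeTH_mul_exp_le_shapeTH_of_profile_total` (binders of the landed lemma VERBATIM except
`h : lifeCost (padW (dictWT sh R C.n₁) D) κ G ≤ lifeCost (padW (dictWT sh R C.n₁) D) (costT sh C K R) G`),
**`card_mul_pshapeTH_le_priceT_of_profile_total`** (binders VERBATIM except
`hκ : lifeCost (padW (dictWT sh (R K) C.n₁) 0) κ q.2 ≤ lifeCost (padW (dictWT sh (R K) C.n₁) 0) (costT sh C K (R K)) q.2`);
two `example`s: the stepwise forms follow by `lifeCostT_mono`.

HONEST SCOPE.  Arithmetic only; a by-name WEAKENING of one displayed binder (class R of the END's H3 cost field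
UNCHANGED until the owner's M5-1 discharges it); `hslack` stays a displayed hypothesis; nothing of H3 ∕ (B) ∕ BetaPertH
touched; NE7b NOT proved; spine 0∕9.  HONEST DEPENDENCY (cell): continuum YM on T⁴ ⇐ BetaPertH ∧ nine spine estimates
(0/9 proved); BetaPertH ⇐ (D1) ∧ (D4) ∧ CAP+tail; G-an2-4 gates asym, D1 and NE2/3/4.  This file changes none of it.
-/

open Finset
open Literature.MathematicalPhysics.QuantumFieldTheory.Balaban1983to89
open T4PersistenceDictionary T4PersistentHistoryCount T4BankedInduction T4PrintedShapeBanking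
open T4LiveClassFibration T4LiveStructureGas T4BranchingRecordsGas T4TaggedShapeBanking T4PartnerMultiplicity
open Summit.QuantumFields.BalabanUV.T4Continuum.LateMergers
open Summit.QuantumFields.BalabanUV.T4Continuum.HistorySocketTH
open Summit.QuantumFields.BalabanUV.T4Continuum.HistoryAssemblyTerms
open Summit.QuantumFields.BalabanUV.T4Continuum.HistoryAssemblyTermsLE
open Summit.QuantumFields.BalabanUV.T4Continuum.HistoryConstants
open Summit.QuantumFields.BalabanUV.T4Continuum.HistoryAssemblyPrice
open Summit.QuantumFields.BalabanUV.T4Continuum.HistoryBankingLE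
open Summit.QuantumFields.BalabanUV.T4Continuum.HistoryAssemblyMult
open Summit.QuantumFields.BalabanUV.T4Continuum.HistoryAssemblyMultProfile

namespace Summit.QuantumFields.BalabanUV.T4Continuum.HistoryAssemblyMultProfileTotal

noncomputable section

/-! ## The class-linear slack at a profile level, cost reading in TOTAL form -/

section Profile

variable {ε γ : Type*} [DecidableEq ε] {C : T4PrintedShapeBanking.Consts} {O : PrintedO1s}

/-- **PRINT-PRICED TH SHAPE × CLASS-LINEAR FACTOR AT LEVEL `P` ≤ THE TH EXIT'S SHAPE, COST READ IN TOTAL FORM**: as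
`HistoryAssemblyMultProfile.pshapeTH_mul_exp_le_shapeTH_of_profile`, the realised-cost binder being the TOTAL inequality
`lifeCost (padW (dictWT sh R C.n₁) D) κ G ≤ lifeCost (padW (dictWT sh R C.n₁) D) (costT sh C K R) G` over the padded life
(R-OWNER-42-2). [folklore] -/
theorem pshapeTH_mul_exp_le_shapeTH_of_profile_total (sh : ε → PEv) {θ P : ℝ} (hθ : 0 ≤ θ)
    (hslack : C.a + θ ≤ O.γ₀ * O.A₁ ^ 2 / 2) (hP1 : 1 ≤ P) {Δ Λ' : ℝ} (hΔ : 0 ≤ Δ) (hΛ : 0 ≤ Λ')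
    (R : ℕ → ℕ) (g : ℕ → ℝ) (K D : ℕ) {κ : Gen ε → ℕ → ℝ} {G : Gen ε}
    (hP : ∀ e ∈ G.events, (sh e).kind = 0 → P ≤ p0Profile C.A₀ C.p₀ (g (sh e).step))
    (h : lifeCost (padW (dictWT sh R C.n₁) D) κ G ≤ lifeCost (padW (dictWT sh R C.n₁) D) (costT sh C K R) G) :
    pshapeTH sh O C Δ Λ' R g D κ G * Real.exp (θ * P * birthLinT sh G) ≤
      HistoryConstants.shapeTH sh C Δ Λ' R g K D G := by
  unfold pshapeTH HistoryConstants.shapeTH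
  have hc : Real.exp (-credits (pcredit O C g ∘ sh) G) * Real.exp (θ * P * birthLinT sh G) ≤
      Real.exp (-credits (credit C g ∘ sh) G) := by
    rw [← Real.exp_add]
    exact Real.exp_le_exp.2 (by linarith [creditsT_slack_of_profile sh hθ hslack hP1 g hP])
  have hl : Real.exp (lifeCost (padW (dictWT sh R C.n₁) D) κ G) ≤
      Real.exp (lifeCost (padW (dictWT sh R C.n₁) D) (costT sh C K R) G) :=
    Real.exp_le_exp.2 h
  have hraw : Real.exp (-credits (pcredit O C g ∘ sh) G) * Real.exp (lifeCost (padW (dictWT sh R C.n₁) D) κ G) *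
      Real.exp (θ * P * birthLinT sh G) ≤ Real.exp (-credits (credit C g ∘ sh) G) *
        Real.exp (lifeCost (padW (dictWT sh R C.n₁) D) (costT sh C K R) G) := by
    calc _ = Real.exp (-credits (pcredit O C g ∘ sh) G) * Real.exp (θ * P * birthLinT sh G) *
          Real.exp (lifeCost (padW (dictWT sh R C.n₁) D) κ G) := by ring
      _ ≤ _ := mul_le_mul hc hl (Real.exp_pos _).le (Real.exp_pos _).le
  have hpre : 0 ≤ Δ * Λ' ^ partnerAges (PEv.step ∘ sh) G := mul_nonneg hΔ (pow_nonneg hΛ _)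
  calc _ = Δ * Λ' ^ partnerAges (PEv.step ∘ sh) G * (Real.exp (-credits (pcredit O C g ∘ sh) G) *
        Real.exp (lifeCost (padW (dictWT sh R C.n₁) D) κ G) * Real.exp (θ * P * birthLinT sh G)) := by ring
    _ ≤ Δ * Λ' ^ partnerAges (PEv.step ∘ sh) G * (Real.exp (-credits (credit C g ∘ sh) G) *
        Real.exp (lifeCost (padW (dictWT sh R C.n₁) D) (costT sh C K R) G)) :=
      mul_le_mul_of_nonneg_left hraw hpre
    _ = _ := by ring

/-- the landed STEPWISE lemma is the total one composed with `lifeCostT_mono` (kernel-checked round trip; binders and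
conclusion LITERALLY those of `HistoryAssemblyMultProfile.pshapeTH_mul_exp_le_shapeTH_of_profile`). [folklore] -/
example (sh : ε → PEv) {θ P : ℝ} (hθ : 0 ≤ θ)
    (hslack : C.a + θ ≤ O.γ₀ * O.A₁ ^ 2 / 2) (hP1 : 1 ≤ P) {Δ Λ' : ℝ} (hΔ : 0 ≤ Δ) (hΛ : 0 ≤ Λ')
    (R : ℕ → ℕ) (g : ℕ → ℝ) (K D : ℕ) {κ : Gen ε → ℕ → ℝ} {G : Gen ε}
    (hP : ∀ e ∈ G.events, (sh e).kind = 0 → P ≤ p0Profile C.A₀ C.p₀ (g (sh e).step))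
    (h : ∀ n ∈ life (padW (dictWT sh R C.n₁) D) G, κ G n ≤ costT sh C K R G n) :
    pshapeTH sh O C Δ Λ' R g D κ G * Real.exp (θ * P * birthLinT sh G) ≤
      HistoryConstants.shapeTH sh C Δ Λ' R g K D G :=
  pshapeTH_mul_exp_le_shapeTH_of_profile_total sh hθ hslack hP1 hΔ hΛ R g K D hP (lifeCostT_mono h)

/-- **MULTIPLICITY × DISCOUNTED PRINTED PRICE ≤ TREE-SLOT PRICE, THE SLACK READ AT A PROFILE LEVEL `P`, COST READ IN
TOTAL FORM** (IR-42-2, T0): as `HistoryAssemblyMultProfile.card_mul_pshapeTH_le_priceT_of_profile` with the realised-cost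
binder `hκ : lifeCost (padW (dictWT sh (R K) C.n₁) 0) κ q.2 ≤ lifeCost (padW (dictWT sh (R K) C.n₁) 0) (costT sh C K (R K)) q.2`
(R-OWNER-42-2: print's per-region-future ∕ per-merger-reserve budgets are totals); every stepwise supplier still fits
through `lifeCostT_mono`. [folklore] -/
theorem card_mul_pshapeTH_le_priceT_of_profile_total (sh : ε → PEv) {θ P Λm Λr Λ' : ℝ} (hθ : 0 ≤ θ)
    (hslack : C.a + θ ≤ O.γ₀ * O.A₁ ^ 2 / 2) (hP1 : 1 ≤ P) (hΛm : 0 ≤ Λm) (hΛr : 0 ≤ Λr) (hΛ : Λm * Λr ≤ Λ')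
    (R : ℕ → ℕ → ℕ) (g : ℕ → ℕ → ℝ) (K : ℕ) {q : γ × Gen ε} {κ : Gen ε → ℕ → ℝ} {N Ξ : ℝ}
    (hP : ∀ e ∈ q.2.events, (sh e).kind = 0 → P ≤ p0Profile C.A₀ C.p₀ (g K (sh e).step))
    (hκ : lifeCost (padW (dictWT sh (R K) C.n₁) 0) κ q.2 ≤ lifeCost (padW (dictWT sh (R K) C.n₁) 0) (costT sh C K (R K)) q.2)
    (hN : N ≤ Real.exp (θ * P * birthLinT sh q.2 + Ξ) * Λm ^ partnerAges (PEv.step ∘ sh) q.2) :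
    N * (pshapeTH sh O C 1 Λr (R K) (g K) 0 κ q.2 * Real.exp (-Ξ)) ≤ priceT sh C Λ' R g K q := by
  have hps : 0 ≤ pshapeTH sh O C 1 Λr (R K) (g K) 0 κ q.2 := pshapeTH_nonneg sh zero_le_one hΛr _ _ _ _ _
  have h1 : N * (pshapeTH sh O C 1 Λr (R K) (g K) 0 κ q.2 * Real.exp (-Ξ)) ≤
      Real.exp (θ * P * birthLinT sh q.2 + Ξ) * Λm ^ partnerAges (PEv.step ∘ sh) q.2 *
        (pshapeTH sh O C 1 Λr (R K) (g K) 0 κ q.2 * Real.exp (-Ξ)) :=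
    mul_le_mul_of_nonneg_right hN (mul_nonneg hps (Real.exp_pos _).le)
  have h2 : Real.exp (θ * P * birthLinT sh q.2 + Ξ) * Λm ^ partnerAges (PEv.step ∘ sh) q.2 *
      (pshapeTH sh O C 1 Λr (R K) (g K) 0 κ q.2 * Real.exp (-Ξ)) =
      Λm ^ partnerAges (PEv.step ∘ sh) q.2 *
        (pshapeTH sh O C 1 Λr (R K) (g K) 0 κ q.2 * Real.exp (θ * P * birthLinT sh q.2)) := by
    have e : Real.exp (θ * P * birthLinT sh q.2 + Ξ) * Real.exp (-Ξ) = Real.exp (θ * P * birthLinT sh q.2) := by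
      rw [← Real.exp_add, add_neg_cancel_right]
    calc _ = Λm ^ partnerAges (PEv.step ∘ sh) q.2 * (pshapeTH sh O C 1 Λr (R K) (g K) 0 κ q.2 *
          (Real.exp (θ * P * birthLinT sh q.2 + Ξ) * Real.exp (-Ξ))) := by ring
      _ = _ := by rw [e]
  have h3 : pshapeTH sh O C 1 Λr (R K) (g K) 0 κ q.2 * Real.exp (θ * P * birthLinT sh q.2) ≤
      HistoryConstants.shapeTH sh C 1 Λr (R K) (g K) K 0 q.2 :=
    pshapeTH_mul_exp_le_shapeTH_of_profile_total sh hθ hslack hP1 zero_le_one hΛr (R K) (g K) K 0 hP hκ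
  have hE : 0 ≤ Real.exp (-credits (credit C (g K) ∘ sh) q.2) *
      Real.exp (lifeCost (dictWT sh (R K) C.n₁) (costT sh C K (R K)) q.2) := by positivity
  have h4 : Λm ^ partnerAges (PEv.step ∘ sh) q.2 * HistoryConstants.shapeTH sh C 1 Λr (R K) (g K) K 0 q.2 ≤
      priceT sh C Λ' R g K q := by
    rw [shapeTH_zero_one, priceT, ← mul_assoc, ← mul_pow]
    exact mul_le_mul_of_nonneg_right (pow_le_pow_left₀ (mul_nonneg hΛm hΛr) hΛ _) hE
  calc _ ≤ _ := h1
    _ = _ := h2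
    _ ≤ Λm ^ partnerAges (PEv.step ∘ sh) q.2 * HistoryConstants.shapeTH sh C 1 Λr (R K) (g K) K 0 q.2 :=
      mul_le_mul_of_nonneg_left h3 (pow_nonneg hΛm _)
    _ ≤ _ := h4

/-- the landed STEPWISE lemma is the total one composed with `lifeCostT_mono` (kernel-checked round trip; binders and
conclusion LITERALLY those of `HistoryAssemblyMultProfile.card_mul_pshapeTH_le_priceT_of_profile`). [folklore] -/
example (sh : ε → PEv) {θ P Λm Λr Λ' : ℝ} (hθ : 0 ≤ θ)
    (hslack : C.a + θ ≤ O.γ₀ * O.A₁ ^ 2 / 2) (hP1 : 1 ≤ P) (hΛm : 0 ≤ Λm) (hΛr : 0 ≤ Λr) (hΛ : Λm * Λr ≤ Λ')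
    (R : ℕ → ℕ → ℕ) (g : ℕ → ℕ → ℝ) (K : ℕ) {q : γ × Gen ε} {κ : Gen ε → ℕ → ℝ} {N Ξ : ℝ}
    (hP : ∀ e ∈ q.2.events, (sh e).kind = 0 → P ≤ p0Profile C.A₀ C.p₀ (g K (sh e).step))
    (hκ : ∀ n ∈ life (padW (dictWT sh (R K) C.n₁) 0) q.2, κ q.2 n ≤ costT sh C K (R K) q.2 n)
    (hN : N ≤ Real.exp (θ * P * birthLinT sh q.2 + Ξ) * Λm ^ partnerAges (PEv.step ∘ sh) q.2) :
    N * (pshapeTH sh O C 1 Λr (R K) (g K) 0 κ q.2 * Real.exp (-Ξ)) ≤ priceT sh C Λ' R g K q :=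
  card_mul_pshapeTH_le_priceT_of_profile_total sh hθ hslack hP1 hΛm hΛr hΛ R g K hP (lifeCostT_mono hκ) hN

end Profile

end

end Summit.QuantumFields.BalabanUV.T4Continuum.HistoryAssemblyMultProfileTotal
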